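import Summits.BirchSwinnertonDyer.BirchSwinnertonDyer.Theorems.ResidualThetaTransportAtTwoAwayDefs
import Summits.BirchSwinnertonDyer.BirchSwinnertonDyer.Theorems.ResidualThetaTransportAtTwoResidualSignedLambdaLowerCMAtTwoRhoLayerPairingCoeffSmul
import HarnessLib

/-!
# ASSEMBLY clause C1 of the one-pair glue: the PLACE CUT at the pins — (S4₂)_ℤ ∧ (S4₀)_ℤ ∧ EH ⟹ `hDHrel` on `𝔉₂ × P_{S₀}`, integer slack

Route `ResidualThetaTransportAtTwo` (RTT), crux RSL_g `ResidualSignedLambdaLowerCMAtTwo` (stmt-BirchSwinnertonDyer-22608), line «onepair» (v3d),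
`Cruxes/ResidualSignedLambdaLowerCMAtTwo/ASSEMBLY-SPEC-g19.md` clause C1; LEAD `prover-bsd-wall-rtt-p2` g19 (`--supports 22608 --as helper`, closes
nothing). THEOREMS ONLY (no definition, no named fact, no instance, no `sorry`). BSD is not proved by any of this; RSL_g is OPEN.

WHAT. The place cut of `PlaceCutGlue.hDHrel_of_placeCut` (w2 g17: S4₂ ∧ S4₀ ∧ EH ⟹ `hDHrel`, abstract `A`-linear carriers), RE-RUN DIRECTLY on the
carriers of the line in the `ℤ₂`-currency of the registered texts with INTEGER slack (`(m : ℤ₂) •`, `m ∈ ℤ ∖ 0`): `𝔉₂ = Hom(E(ℚ_{∞,v})ⁿ, ℤ₂)`,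
`P_{S₀} = PAway`, `D₂ = Dloc π.v`, the relaxed Selmer SUBGROUP `selRelSubgroup` (an `AddSubgroup` — no `ℤ₂`-structure — which is why the slack must be
integral: the cut evaluates the hypothesis at `m₀ • s`, sidea-k1 g20's friction), `c₂ := π₂.c₂`, the S₀-side sum `∑_w ∑ᶠ_c χ w c (locAway s w c)`,
`ld₂ := π.locd₂`, `ldS := πₐ.locdS`. Only additivity is used (`map_zsmul`), plus the two `ℤ₂`-compatibilities of the pins for the correction
`x ↦ C (ι m₁) • x`: `πₐ.hlocdS_smul` (field) and `π.locd₂ (C (ι a) • x) = a • π.locd₂ x` (w2's `locd₂_C_smul_eq_smul` + `pair_padicInt_smul_of_toZModPow`,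
restated here as `OnePairPins.locd₂_padicInt_smul'`). Inputs = EH (registered text at `(π, π₂, πₐ)`, verbatim shape) and S4₂ / S4₀ in INTEGER-slack
form (the descent from the registered `ℤ₂`-slack is `…SupplySlack`, applied by the assembly C8).

* `OnePair.hDHrel_of_pins` — `∀ t : 𝔉₂ × P_{S₀}`, if `π₂.c₂ t.1 (loc₂ s) + ∑∑ t.2 w c (locAway s w c) = 0` for every relaxed Selmer class `s`, then
  `(m : ℤ₂) • t = (π.locd₂ x, πₐ.locdS x)` for some `m ∈ ℤ ∖ 0`, `x ∈ 𝐇¹`.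

References: [Kobayashi2003] Thm. 7.3 ((7.17)–(7.21)); [MilneADT2006] Ch. I, Thm. 4.10 (b); [GreenbergVatsal2000] §2 Prop. 2.4.
-/

set_option autoImplicit false
-- the Theorems namespace of this sub repeats the summit name by design (D-0017 nested layout)
set_option linter.dupNamespace false

noncomputable section

open scoped Classical

namespace Summit.BirchSwinnertonDyer.BirchSwinnertonDyer.Theorems.OnePair

open Literature.NumberTheory.EllipticCurves Literature.NumberTheory.EllipticCurves.GreenbergSelmer
open Literature.NumberTheory.GaloisRepresentations NumberField IsDedekindDomain Field
open Kobayashi2003 Rat.HeightOneSpectrum PowerSeries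
open Summit.BirchSwinnertonDyer.BirchSwinnertonDyer.Theorems.ThetaTransport

variable {S : Set (PadicAlgCl 2)} {W : WeierstrassCurve ℚ} [W.IsElliptic] {κ : ZpExtension ℚ 2} {γ : absoluteGaloisGroup ℚ}
  {S₀ : Finset (HeightOneSpectrum (𝓞 ℚ))} {n : ℕ} {ρ : FramedGaloisRep ℚ ↥(padicCoeffIntegers S) 2}
  {Θ : ∀ v : HeightOneSpectrum (𝓞 ℚ), ((2 : ℕ) : 𝓞 ℚ) ∈ v.asIdeal → (Cofree ρ ↥(padicCoeffField S) ≃+ (Fin n → ↥(W.geomPrimaryTorsion 2)))}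
  {hΘ : ∀ v hv (δ : absoluteGaloisGroup (v.adicCompletion ℚ)) m i,
    Θ v hv (resGalOfEmb (closureEmb (K := ℚ) (v.adicCompletion ℚ)) δ • m) i = resGalOfEmb (closureEmb (K := ℚ) (v.adicCompletion ℚ)) δ • Θ v hv m i}
  {I : Kato2004.IwasawaH1DataCoeff (FramedGaloisRep.toGaloisRep ρ) 2 κ γ}
  {Sg : AddSubgroup (subgroupH1 κ.kerSubgroup (Cofree ρ ↥(padicCoeffField S)))} [Module ↥(padicCoeffIntegers S) ↥Sg]
  (π : OnePairPins S W κ γ S₀ n ρ Θ hΘ I Sg)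

/-- `locd₂ (C (ι a) • x) = a • locd₂ x` for the pins (w2's `locd₂_C_smul_eq_smul` fed with `pair_padicInt_smul_of_toZModPow` and the pins `hpair`,
`hlocd₂`; primed twin of `…SupplySlack`'s lemma, kept here so that this file depends on landed modules only).
[cite: Kato2004Asterisque, §12.2 (p. 220), §13.8 (pp. 228–229)] [cite: PerrinRiou1994Invent, §3.6.1] -/
theorem OnePairPins.locd₂_padicInt_smul' (a : ℤ_[2]) (x : I.H) :
    π.locd₂ ((PowerSeries.C (padicIntToCoeffIntegers S a) : IwasawaAlgebraO S) • x) = a • π.locd₂ x :=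
  locd₂_C_smul_eq_smul I W π.v
    (hPC := fun m y Q ↦ pair_padicInt_smul_of_toZModPow S ρ W π.ePk π.hμPk π.hadd₁Pk π.hadd₂Pk π.hgalPk (Θ π.v π.hv) κ π.v (hΘ π.v π.hv)
      π.pair π.hpair m a y Q)
    (hlocd := π.hlocd₂) x

variable [Module ℤ_[2] (Dloc S κ ρ π.v)] (π₂ : AtTwoPins S κ ρ S₀ W γ n Θ hΘ I Sg π)
  [∀ w : ↥S₀, Module ℤ_[2] (Dloc S κ ρ (w : HeightOneSpectrum (𝓞 ℚ)))] (πₐ : AwayPins S κ ρ S₀ W γ n Θ hΘ I Sg π)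

omit [W.IsElliptic] [Module ↥(padicCoeffIntegers S) ↥Sg] [∀ w : ↥S₀, Module ℤ_[2] (Dloc S κ ρ (w : HeightOneSpectrum (𝓞 ℚ)))] in
/-- `locAway` is additive in the class: `locAway (m • s) = m • locAway s` for `m ∈ ℤ`. [cite: GreenbergVatsal2000, §2] -/
theorem locAway_zsmul (m : ℤ) (s : subgroupH1 κ.kerSubgroup (Cofree ρ ↥(padicCoeffField S))) (w : ↥S₀)
    (c : Cosets κ (w : HeightOneSpectrum (𝓞 ℚ))) : locAway S κ ρ S₀ (m • s) w c = m • locAway S κ ρ S₀ s w c := by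
  unfold locAway
  rw [map_zsmul, map_zsmul]

-- the nested `∑ᶠ` character sums over the pinned structures exceed the default budget
set_option maxHeartbeats 800000 in
/-- **C1 — the place cut at the pins, integer slack.** For `t = (z, χ) ∈ 𝔉₂ × P_{S₀}` with `π₂.c₂ z (loc₂ s) + ∑_w ∑ᶠ_c χ w c (locAway s w c) = 0` for
every `s ∈ selRelSubgroup`: given EH (registered text, at `(π, π₂, πₐ)`) and the INTEGER-slack readings of S4₂ (side condition `locd_S x = 0`) and S4₀,
there are `m ∈ ℤ ∖ 0` and `x ∈ 𝐇¹` with `(m : ℤ₂) • t = (π.locd₂ x, πₐ.locdS x)`. Proof = the place cut (Kobayashi Thm. 7.3): restrict `χ` to the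
classes with `loc₂ s = 0` (S4₀ gives `(m₀ : ℤ₂) • χ = locd_S x₀`), evaluate the hypothesis at `m₀ • s` and reciprocity at `x₀` to see that
`(m₀ : ℤ₂) • z − locd₂ x₀` kills `loc₂` of every relaxed class, apply S4₂, recombine with `x := C (ι m₁) • x₀ + x₁`.
[cite: Kobayashi2003, Thm. 7.3 ((7.17)–(7.21), pp. 12–13)] [cite: MilneADT2006, Ch. I, Thm. 4.10 (b)] [cite: GreenbergVatsal2000, §2 Prop. 2.4] -/
theorem hDHrel_of_pins
    (hEH : ∀ (x : I.H) (s : subgroupH1 κ.kerSubgroup (Cofree ρ ↥(padicCoeffField S))), s ∈ selRelSubgroup S κ ρ S₀ →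
      π₂.c₂ (π.locd₂ x) (locKer S κ ρ π.v s) +
        ∑ w : ↥S₀, ∑ᶠ c : Cosets κ (w : HeightOneSpectrum (𝓞 ℚ)), πₐ.locdS x w c (locAway S κ ρ S₀ s w c) = 0)
    (h42 : ∀ z : (Fin n → ↥(Sprung2012.localTowerPointsOfEmb κ (closureEmb (K := ℚ) (π.v.adicCompletion ℚ)) W)) →+ ℤ_[2],
      (∀ s : subgroupH1 κ.kerSubgroup (Cofree ρ ↥(padicCoeffField S)), s ∈ selRelSubgroup S κ ρ S₀ → π₂.c₂ z (locKer S κ ρ π.v s) = 0) →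
      ∃ m : ℤ, m ≠ 0 ∧ ∃ x : I.H, πₐ.locdS x = 0 ∧ (m : ℤ_[2]) • z = π.locd₂ x)
    (h40 : ∀ χ : PAway S κ ρ S₀,
      (∀ s : subgroupH1 κ.kerSubgroup (Cofree ρ ↥(padicCoeffField S)), s ∈ selRelSubgroup S κ ρ S₀ → locKer S κ ρ π.v s = 0 →
        ∑ w : ↥S₀, ∑ᶠ c : Cosets κ (w : HeightOneSpectrum (𝓞 ℚ)), χ w c (locAway S κ ρ S₀ s w c) = 0) →
      ∃ m : ℤ, m ≠ 0 ∧ ∃ x : I.H, (m : ℤ_[2]) • χ = πₐ.locdS x)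
    (t : ((Fin n → ↥(Sprung2012.localTowerPointsOfEmb κ (closureEmb (K := ℚ) (π.v.adicCompletion ℚ)) W)) →+ ℤ_[2]) × PAway S κ ρ S₀)
    (ht : ∀ s : subgroupH1 κ.kerSubgroup (Cofree ρ ↥(padicCoeffField S)), s ∈ selRelSubgroup S κ ρ S₀ →
      π₂.c₂ t.1 (locKer S κ ρ π.v s) +
        ∑ w : ↥S₀, ∑ᶠ c : Cosets κ (w : HeightOneSpectrum (𝓞 ℚ)), t.2 w c (locAway S κ ρ S₀ s w c) = 0) :
    ∃ m : ℤ, m ≠ 0 ∧ ∃ x : I.H, (m : ℤ_[2]) • t = (π.locd₂ x, πₐ.locdS x) := by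
  obtain ⟨z, χ⟩ := t
  -- Step 1: `χ` kills `locAway` of the relaxed classes with `loc₂ s = 0`; S4₀ gives `(m₀ : ℤ₂) • χ = locd_S x₀`
  have hχ : ∀ s : subgroupH1 κ.kerSubgroup (Cofree ρ ↥(padicCoeffField S)), s ∈ selRelSubgroup S κ ρ S₀ → locKer S κ ρ π.v s = 0 →
      ∑ w : ↥S₀, ∑ᶠ c : Cosets κ (w : HeightOneSpectrum (𝓞 ℚ)), χ w c (locAway S κ ρ S₀ s w c) = 0 := by
    intro s hs h0
    have h := ht s hs
    rw [h0, map_zero, zero_add] at h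
    exact h
  obtain ⟨m₀, hm₀, x₀, hx₀⟩ := h40 χ hχ
  -- Step 2: `(m₀ : ℤ₂) • z − locd₂ x₀` kills `loc₂` of every relaxed class (hypothesis at `m₀ • s` versus reciprocity at `x₀`)
  have hz' : ∀ s : subgroupH1 κ.kerSubgroup (Cofree ρ ↥(padicCoeffField S)), s ∈ selRelSubgroup S κ ρ S₀ →
      π₂.c₂ ((m₀ : ℤ_[2]) • z - π.locd₂ x₀) (locKer S κ ρ π.v s) = 0 := by
    intro s hs
    have h1 := ht (m₀ • s) (AddSubgroup.zsmul_mem _ hs m₀)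
    have h2 := hEH x₀ s hs
    -- the S₀-side sums of `h1` and `h2` agree
    have hsum : ∑ w : ↥S₀, ∑ᶠ c : Cosets κ (w : HeightOneSpectrum (𝓞 ℚ)), χ w c (locAway S κ ρ S₀ (m₀ • s) w c) =
        ∑ w : ↥S₀, ∑ᶠ c : Cosets κ (w : HeightOneSpectrum (𝓞 ℚ)), πₐ.locdS x₀ w c (locAway S κ ρ S₀ s w c) := by
      refine Finset.sum_congr rfl fun w _ ↦ finsum_congr fun c ↦ ?_
      rw [← hx₀, Pi.smul_apply, Pi.smul_apply, CharacterModule.smul_apply, Int.cast_smul_eq_zsmul, locAway_zsmul]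
    -- the 2-side terms: `c₂ ((m₀ : ℤ₂) • z) (loc₂ s) = c₂ z (loc₂ (m₀ • s))`
    have h2side : π₂.c₂ ((m₀ : ℤ_[2]) • z) (locKer S κ ρ π.v s) = π₂.c₂ z (locKer S κ ρ π.v (m₀ • s)) := by
      rw [map_zsmul (locKer S κ ρ π.v) m₀ s, π₂.hc₂_smul, Int.cast_smul_eq_zsmul]
    rw [map_sub]
    change π₂.c₂ ((m₀ : ℤ_[2]) • z) (locKer S κ ρ π.v s) - π₂.c₂ (π.locd₂ x₀) (locKer S κ ρ π.v s) = 0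
    rw [h2side, sub_eq_zero]
    -- both equal `−(the common S₀-side sum)`
    rw [hsum] at h1
    exact (eq_neg_of_add_eq_zero_left h1).trans (eq_neg_of_add_eq_zero_left h2).symm
  -- Step 3: S4₂ on the corrected functional
  obtain ⟨m₁, hm₁, x₁, hx₁S, hx₁⟩ := h42 _ hz'
  -- Step 4: recombine with `x := C (ι m₁) • x₀ + x₁`
  refine ⟨m₁ * m₀, mul_ne_zero hm₁ hm₀, (PowerSeries.C (padicIntToCoeffIntegers S (m₁ : ℤ_[2])) : IwasawaAlgebraO S) • x₀ + x₁, ?_⟩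
  refine Prod.ext ?_ ?_
  · change ((m₁ * m₀ : ℤ) : ℤ_[2]) • z = π.locd₂ ((PowerSeries.C (padicIntToCoeffIntegers S (m₁ : ℤ_[2])) : IwasawaAlgebraO S) • x₀ + x₁)
    rw [map_add, π.locd₂_padicInt_smul', ← hx₁, smul_sub, Int.cast_mul, mul_smul, add_sub_cancel]
  · change ((m₁ * m₀ : ℤ) : ℤ_[2]) • χ = πₐ.locdS ((PowerSeries.C (padicIntToCoeffIntegers S (m₁ : ℤ_[2])) : IwasawaAlgebraO S) • x₀ + x₁)
    rw [map_add, πₐ.hlocdS_smul, hx₁S, add_zero, ← hx₀, Int.cast_mul, mul_smul]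

end Summit.BirchSwinnertonDyer.BirchSwinnertonDyer.Theorems.OnePair

end
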